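import Summits.QuantumFields.BalabanUV.Beta.GAN24.TorusPeriodise
import Literature.MathematicalPhysics.QuantumFieldTheory.Balaban1983to89.Beta.BlockEffectiveAction

/-!
# `BalabanUV.Beta.GAN24.TorusJunction` — binder row G-an2-4 / (CONV-C), S6 dictionary (mm channel), leaf P1-L13b part 2 (S6mm-2b):
# **THE JUNCTION an2 ↔ b05 ON EVERY TORUS** — the `M`-periodisation of an2's multiplier-response kernel `wΦ^{(N)}` (the mm block of the
# packed resolvent `KInv N`, `GAN24/TransverseDictionary.KInvStep_inr_inr`) IS `2·N^{−(d+5)}` times the genuine (1.65) block effective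
# action `Δ_k` of Bałaban at `n = N` as typed by the β cell / b05 (`Beta.BlockEffectiveAction.DelK = n^{−d}·H_kᴴ(½(∂)ᴴ∂)H_k`,
# `H_k = GQ*(QGQ*)⁻¹` (1.103)):  `Σ_{t∈ℤ^{d+1}} wΦ κ l (z + pshift M t) = 2·N^{−(d+5)} · Re Δ_k((z mod M, κ), (0, l))`

NOT IN PRINT; OUR PROOF.  HONEST FRAMING (cell contract, verbatim): «discharging `BetaPertH` makes Bałaban's UV stability UNCONDITIONAL — a
real constructive-QFT result; it is NOT the continuum limit and NOT the Clay problem.»  HONEST DEPENDENCY (verbatim): «continuum YM on T⁴ ⇐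
BetaPertH ∧ nine spine estimates (0/9 proved); BetaPertH ⇐ (D1) ∧ (D4) ∧ CAP+tail; G-an2-4 gates asym, D1 and NE2/3/4.»  This module cites
nothing, mints no fact and instantiates no wall binder; it is finite-dimensional linear algebra over the two lineages' OWN kernel theorems
(an5 `ResolventComposition.curvAdj_curv_Hcol`/`contourSum_Hcol`/`wM_eq_zero` through `GAN24/TorusPeriodise`; b05/an5
`FluctuationProjection.QvOp_Hk_mulVec`, `BlockEffectiveAction.curl_cross_eq_zero`, `DelK`) and the bridges of `GAN24/TorusAvatarBridge`.
«not in print; our proof» (the printed (1.65) = (1.66) dictionary for THE TYPED an2 system is nowhere in [Balaban1984PropagatorsI]).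
NOT summit progress.

THE ARGUMENT (no explicit solution, no uniqueness, no composition law).  §1 **`gram_eq_of_weak`** — two families `u, v` of fields with the
SAME constraints `Q u_i = Q v_i`, each WEAKLY CRITICAL for the energy `‖C·‖²` on `{Q = const}` (`⟨Cw, Cu_i⟩ = 0` for `w ∈ ker Q`), have the
same Gram matrix `⟨Cu_i, Cu_j⟩ = ⟨Cv_i, Cv_j⟩`.  §2 an2's side: `colA b := av (Hper N M l (lift ȳ))` (the torus avatar of the periodised
minimiser column with source at the torus coarse bond `b = (ȳ, l)`): **`QvOp_colA`** `Q_k(colA b) = N^{−(d+2)} e_b` (an2's UNNORMALISED unit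
contour sums through (1.18)'s `η^{d+1}`), **`weak_colA`** (the gauge-free Euler–Lagrange identity transported: `((∂)ᴴ∂)(colA b) =
N²·N^{d+2}·(Q_k)ᴴ(av Φ^per_b)`, `curlAdj_curl_colA`), **`gram_colA`** `⟨∂ colA b, ∂ colA b′⟩ = N²·Φ^per_{b′}(b)`.  §3 b05's side:
`colB b := H_k (N^{−(d+2)} e_b)`: `QvOp_colB`, `weak_colB` (= `curl_cross_eq_zero`), **`gram_colB`** `⟨∂ colB b, ∂ colB b′⟩ =
2·N^{−(d+3)}·Δ_k(b,b′)` (`curl_Hk_single`: `⟨∂H_ke_b, ∂H_ke_{b′}⟩ = 2n^{d}Δ_k(b,b′)` from the DEFINITION of `DelK`).  §4 **`gram_colA_eq_gram_colB`**,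
**`Φper_eq_DelK`** `Φ^per_{b′}(b) = 2·N^{−(d+5)}·Δ_k(b, b′)` and **`tsum_wΦ_pshift_eq_DelK`**:
`∑' t, wΦ (N := N) κ l (z + pshift M t) = 2 * ((N:ℝ)^(d+5))⁻¹ * (DelK N hN M a ha (toTor M z, κ) (0, l)).re` — every `N ≥ 1`, every torus
`M`, every `d`, every dummy `a > 0` (`DelK_indep`).  READING: the factor `2` is an2's `curvAdj ∘ curv = 2·(plain ∂*∂)` (GAPS C-gan24p2-5 (b)(ii));
the exponent `d + 5 = D + 4` is the block-SUM normalisation of an2's `𝒬` squared (`N^{−2(D+1)}`) against b05's `n^{−d}`, `η⁻²` — gan24-p1's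
float64 `K_mm ≈ 2(|p|²𝟙 − ppᵀ)/Lc^{D+4}` (SKELETON-P1 §7(e)) is now a kernel identity on every torus.  With pv09-g11's
`B6Cov2156TorusDelK.deltaPol_eq_DelK` the right-hand side is `2N^{−(d+5)}·deltaPol M N` (the (1.66) matrix); the passage `M → ∞` to p2's
`deltaZ` on `ℤ^{d+1}` and the mm legs of the K-slot binders are `GAN24/MultiplierDictionary` (P1-L13c).
Unit b2b-balaban-gan24-formalise-leaf-18 (gen 5), 2026-08-19.  NOT the K-slot (ff/mixed legs untouched), NOT `BetaPertH`, NOT continuum, NOT Clay.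
-/

open Finset
open scoped BigOperators ComplexConjugate Matrix

namespace Summit.QuantumFields.BalabanUV.Beta.GAN24.TorusJunction

open Literature.MathematicalPhysics.QuantumFieldTheory
open Literature.MathematicalPhysics.QuantumFieldTheory.Balaban1983to89
open Literature.MathematicalPhysics.QuantumFieldTheory.Balaban1983to89.Beta
open AffineAveraging (Site Form1 curv curvAdj contourSum)
open AffineReproduction (contourSumAdj)
open B5Prop11Plancherel (Tor fine)
open B5Block118 (QvOp)
open B5Action121 (CurlOp star_mulVec_dotProduct dotProduct_mulVec_eq_star_conjTranspose_mulVec)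
open FluctuationProjection (Hk QvOp_Hk_mulVec)
open BlockEffectiveAction (DelK curl_cross_eq_zero)
open KernelSpecInstance (wΦ)
open Summit.QuantumFields.BalabanUV.Beta.GAN24.TorusAvatar (toTor liftT Periodic av av_apply toTor_liftT toTor_sub QvOp_av av_contourSumAdj
  curlAdj_curl_av)
open Summit.QuantumFields.BalabanUV.Beta.GAN24.TorusPeriodise (pshift Hper Φper curvAdj_curv_Hper contourSum_Hper periodic_Hper periodic_Φper
  Φper_congr HΦcol_sub_pshift)

noncomputable section

/-! ## §1 The abstract Gram lemma: two constrained critical families with the same constraints have the same Gram matrix -/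

/-- **GRAM LEMMA**.  `C` an «energy» map, `Q` a «constraint» map; two families `u, v` with the same constraints `Q u_i = Q v_i` which are
both WEAKLY CRITICAL (`⟨C w, C u_i⟩ = 0 = ⟨C w, C v_i⟩` for every `w ∈ ker Q`) have the same Gram matrix `⟨C u_i, C u_j⟩ = ⟨C v_i, C v_j⟩`.
(No uniqueness of critical points is needed — they may differ by `ker Q ∩ ker C`.) -/
theorem gram_eq_of_weak {m n k ι : Type*} [Fintype m] [Fintype n] [Fintype k]
    (C : Matrix m n ℂ) (Q : Matrix k n ℂ) (u v : ι → (n → ℂ)) (hQ : ∀ i, Q *ᵥ u i = Q *ᵥ v i)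
    (hu : ∀ i w, Q *ᵥ w = 0 → star (C *ᵥ w) ⬝ᵥ (C *ᵥ u i) = 0)
    (hv : ∀ i w, Q *ᵥ w = 0 → star (C *ᵥ w) ⬝ᵥ (C *ᵥ v i) = 0) (i j : ι) :
    star (C *ᵥ u i) ⬝ᵥ (C *ᵥ u j) = star (C *ᵥ v i) ⬝ᵥ (C *ᵥ v j) := by
  have hwj : Q *ᵥ (u j - v j) = 0 := by rw [Matrix.mulVec_sub, hQ j, sub_self]
  have hwi : Q *ᵥ (u i - v i) = 0 := by rw [Matrix.mulVec_sub, hQ i, sub_self]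
  have h1 : star (C *ᵥ u i) ⬝ᵥ (C *ᵥ (u j - v j)) = 0 := by
    rw [Matrix.star_dotProduct, hu i _ hwj, star_zero]
  have h2 : star (C *ᵥ (u i - v i)) ⬝ᵥ (C *ᵥ v j) = 0 := hv j _ hwi
  have e1 : star (C *ᵥ u i) ⬝ᵥ (C *ᵥ u j) = star (C *ᵥ u i) ⬝ᵥ (C *ᵥ v j) := by
    have : C *ᵥ u j = C *ᵥ v j + C *ᵥ (u j - v j) := by rw [Matrix.mulVec_sub]; abel
    rw [this, dotProduct_add, h1, add_zero]
  have e2 : star (C *ᵥ u i) ⬝ᵥ (C *ᵥ v j) = star (C *ᵥ v i) ⬝ᵥ (C *ᵥ v j) := by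
    have : C *ᵥ u i = C *ᵥ v i + C *ᵥ (u i - v i) := by rw [Matrix.mulVec_sub]; abel
    rw [this, star_add, add_dotProduct, h2, add_zero]
  rw [e1, e2]

/-! ## §2 an2's periodised minimiser columns on the torus: constraint, weak criticality, Gram matrix -/

section An2

variable {d : ℕ} (N : ℕ) [NeZero N] (M : Fin (d + 1) → ℕ) [∀ ν, NeZero (M ν)]

/-- **an2's COLUMN ON THE TORUS**: the avatar of the periodised minimiser column with source at the torus coarse bond `b = (ȳ, l)`. -/
def colA (b : Tor M × Fin (d + 1)) : Tor (fine N M) × Fin (d + 1) → ℂ := av (Hper N M b.2 (liftT b.1))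

/-- **(T1) CONSTRAINT**: `Q_k (colA b) = N^{−(d+2)} · e_b` (an2's unit UNNORMALISED contour sums, read through the (1.18) normalisation). -/
theorem QvOp_colA (b : Tor M × Fin (d + 1)) :
    QvOp N M *ᵥ colA N M b = (((N : ℂ) ^ (d + 2))⁻¹) • (Pi.single b (1 : ℂ) : Tor M × Fin (d + 1) → ℂ) := by
  funext i
  rcases i with ⟨y, μ⟩
  rw [colA, QvOp_av N M (periodic_Hper N M b.2 (liftT b.1)), contourSum_Hper, Pi.smul_apply, smul_eq_mul,
    toTor_liftT, toTor_liftT]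
  congr 1
  by_cases h : μ = b.2 ∧ y = b.1
  · rw [if_pos h]
    have : ((y, μ) : Tor M × Fin (d + 1)) = b := Prod.ext h.2 h.1
    rw [this, Pi.single_eq_same]; simp
  · rw [if_neg h]
    have : ((y, μ) : Tor M × Fin (d + 1)) ≠ b := fun e => h ⟨(congr_arg Prod.snd e), (congr_arg Prod.fst e)⟩
    rw [Pi.single_eq_of_ne this]; simp

/-- The Euler–Lagrange operator on the torus column: `((∂)ᴴ∂)(colA b) = N² · N^{d+2} · (Q_k)ᴴ (av Φ^per_b)`. -/
theorem curlAdj_curl_colA (b : Tor M × Fin (d + 1)) :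
    ((CurlOp (fine N M) (N : ℂ))ᴴ * CurlOp (fine N M) (N : ℂ)) *ᵥ colA N M b
      = ((N : ℂ) ^ 2 * (N : ℂ) ^ (d + 2)) • ((QvOp N M)ᴴ *ᵥ av (Φper N M b.2 (liftT b.1))) := by
  rw [colA, curlAdj_curl_av (fine N M) N (periodic_Hper N M b.2 (liftT b.1)), curvAdj_curv_Hper, mul_smul]
  congr 1
  funext i
  rcases i with ⟨z, κ⟩
  rw [Pi.smul_apply, smul_eq_mul, av_contourSumAdj N M (periodic_Φper N M b.2 (liftT b.1))]

/-- **(T2) WEAK CRITICALITY** of an2's torus column: `⟨∂w, ∂(colA b)⟩ = 0` for every `w ∈ ker Q_k` — the gauge-free Euler–Lagrange identity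
`d*d ℋ = 𝒬ᵀ Φ` (an5's `wM_eq_zero`), transported through the bridges. -/
theorem weak_colA (b : Tor M × Fin (d + 1)) (w : Tor (fine N M) × Fin (d + 1) → ℂ) (hw : QvOp N M *ᵥ w = 0) :
    star (CurlOp (fine N M) (N : ℂ) *ᵥ w) ⬝ᵥ (CurlOp (fine N M) (N : ℂ) *ᵥ colA N M b) = 0 := by
  rw [star_mulVec_dotProduct, Matrix.mulVec_mulVec, curlAdj_curl_colA, dotProduct_smul,
    dotProduct_mulVec_eq_star_conjTranspose_mulVec, Matrix.conjTranspose_conjTranspose, hw, star_zero, zero_dotProduct,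
    smul_zero]

/-- **(T3) GRAM MATRIX** of an2's torus columns: `⟨∂(colA b), ∂(colA b′)⟩ = N² · Φ^per_{b′}(b)` — the periodised multiplier entry. -/
theorem gram_colA (b b' : Tor M × Fin (d + 1)) :
    star (CurlOp (fine N M) (N : ℂ) *ᵥ colA N M b) ⬝ᵥ (CurlOp (fine N M) (N : ℂ) *ᵥ colA N M b')
      = (N : ℂ) ^ 2 * ((Φper N M b'.2 (liftT b'.1) b.2 (liftT b.1) : ℝ) : ℂ) := by
  have hN : ((N : ℂ) ^ (d + 2)) ≠ 0 := pow_ne_zero _ (Nat.cast_ne_zero.2 (NeZero.ne N))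
  rw [star_mulVec_dotProduct, Matrix.mulVec_mulVec, curlAdj_curl_colA, dotProduct_smul,
    dotProduct_mulVec_eq_star_conjTranspose_mulVec, Matrix.conjTranspose_conjTranspose, QvOp_colA, star_smul,
    smul_dotProduct, smul_eq_mul, smul_eq_mul]
  have hs : star (Pi.single b (1 : ℂ) : Tor M × Fin (d + 1) → ℂ) = Pi.single b 1 := by
    funext i; by_cases h : i = b
    · subst h; simp
    · simp [Pi.single_eq_of_ne h]
  rw [hs, single_dotProduct, one_mul, av_apply, star_inv₀, star_pow, Complex.star_def, Complex.conj_natCast]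
  field_simp

end An2

/-! ## §3 b05's minimiser columns: constraint, weak criticality (`curl_cross_eq_zero`), Gram matrix `= 2N^{−(d+3)}·Δ_k` -/

section B05

variable {d : ℕ} (N : ℕ) [NeZero N] (hN : 1 ≤ N) (M : Fin (d + 1) → ℕ) [∀ ν, NeZero (M ν)] (a : ℝ) (ha : 0 < a)

/-- **b05's COLUMN**: `H_k` ((1.103), `FluctuationProjection.Hk`) applied to the SAME datum `N^{−(d+2)} e_b`. -/
def colB (b : Tor M × Fin (d + 1)) : Tor (fine N M) × Fin (d + 1) → ℂ :=
  Hk N hN M a ha *ᵥ ((((N : ℂ) ^ (d + 2))⁻¹) • (Pi.single b (1 : ℂ) : Tor M × Fin (d + 1) → ℂ))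

/-- (T1′) constraint: `Q_k (colB b) = N^{−(d+2)} e_b` (`Q_kH_k = 1`). -/
theorem QvOp_colB (b : Tor M × Fin (d + 1)) :
    QvOp N M *ᵥ colB N hN M a ha b = (((N : ℂ) ^ (d + 2))⁻¹) • (Pi.single b (1 : ℂ) : Tor M × Fin (d + 1) → ℂ) := by
  rw [colB, QvOp_Hk_mulVec]

/-- (T2′) weak criticality: `⟨∂w, ∂(colB b)⟩ = 0` for `w ∈ ker Q_k` (an5's `BlockEffectiveAction.curl_cross_eq_zero`). -/
theorem weak_colB (b : Tor M × Fin (d + 1)) (w : Tor (fine N M) × Fin (d + 1) → ℂ) (hw : QvOp N M *ᵥ w = 0) :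
    star (CurlOp (fine N M) (N : ℂ) *ᵥ w) ⬝ᵥ (CurlOp (fine N M) (N : ℂ) *ᵥ colB N hN M a ha b) = 0 :=
  curl_cross_eq_zero N hN M a ha w hw _

/-- Reading an entry through a unit vector: `(X e_j)_i = X_{ij}`. -/
theorem mulVec_single_one_apply {ι : Type*} [Fintype ι] [DecidableEq ι] (X : Matrix ι ι ℂ) (i j : ι) :
    (X *ᵥ (Pi.single j (1 : ℂ) : ι → ℂ)) i = X i j := by
  simp only [Matrix.mulVec, dotProduct, Pi.single_apply, mul_ite, mul_one, mul_zero, Finset.sum_ite_eq', Finset.mem_univ, if_true]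

/-- `star e_b = e_b` for the unit vector with entry `1`. -/
theorem star_single_one {ι : Type*} [DecidableEq ι] (b : ι) : star (Pi.single b (1 : ℂ) : ι → ℂ) = Pi.single b 1 := by
  funext i; by_cases h : i = b
  · subst h; simp
  · simp [Pi.single_eq_of_ne h]

/-- The bilinear curl energy of two `H_k` columns is `2n^{d}` times the entry of `Δ_k` (`DelK := n^{−d}·H_kᴴ(½(∂)ᴴ∂)H_k`; here `d ↦ d+1`). -/
theorem curl_Hk_single (b b' : Tor M × Fin (d + 1)) :
    star (CurlOp (fine N M) (N : ℂ) *ᵥ (Hk N hN M a ha *ᵥ (Pi.single b (1 : ℂ))))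
        ⬝ᵥ (CurlOp (fine N M) (N : ℂ) *ᵥ (Hk N hN M a ha *ᵥ (Pi.single b' (1 : ℂ))))
      = 2 * (N : ℂ) ^ (d + 1) * DelK N hN M a ha b b' := by
  have hN0 : ((N : ℂ) ^ (d + 1)) ≠ 0 := pow_ne_zero _ (Nat.cast_ne_zero.2 (NeZero.ne N))
  have hD : DelK N hN M a ha b b' = ((N : ℂ) ^ (d + 1))⁻¹ * ((1 / 2 : ℂ) *
      ((Hk N hN M a ha)ᴴ *ᵥ (((CurlOp (fine N M) (N : ℂ))ᴴ * CurlOp (fine N M) (N : ℂ)) *ᵥ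
        (Hk N hN M a ha *ᵥ (Pi.single b' (1 : ℂ))))) b) := by
    rw [DelK, Matrix.smul_apply, smul_eq_mul,
      ← mulVec_single_one_apply ((Hk N hN M a ha)ᴴ * ((1 / 2 : ℂ) • ((CurlOp (fine N M) (N : ℂ))ᴴ * CurlOp (fine N M) (N : ℂ)))
        * Hk N hN M a ha) b b',
      ← Matrix.mulVec_mulVec, ← Matrix.mulVec_mulVec, Matrix.smul_mulVec, Matrix.mulVec_smul, Pi.smul_apply, smul_eq_mul]
  rw [star_mulVec_dotProduct, Matrix.mulVec_mulVec, star_mulVec_dotProduct, star_single_one, single_dotProduct, one_mul, hD]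
  field_simp

/-- **(T3′) GRAM MATRIX** of b05's columns: `⟨∂(colB b), ∂(colB b′)⟩ = 2·N^{−(d+3)}·Δ_k(b, b′)`. -/
theorem gram_colB (b b' : Tor M × Fin (d + 1)) :
    star (CurlOp (fine N M) (N : ℂ) *ᵥ colB N hN M a ha b) ⬝ᵥ (CurlOp (fine N M) (N : ℂ) *ᵥ colB N hN M a ha b')
      = 2 * ((N : ℂ) ^ (d + 3))⁻¹ * DelK N hN M a ha b b' := by
  have hN0 : (N : ℂ) ≠ 0 := Nat.cast_ne_zero.2 (NeZero.ne N)
  rw [colB, colB, Matrix.mulVec_smul, Matrix.mulVec_smul, Matrix.mulVec_smul, Matrix.mulVec_smul, star_smul, smul_dotProduct,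
    dotProduct_smul, curl_Hk_single, smul_eq_mul, smul_eq_mul, star_inv₀, star_pow, Complex.star_def, Complex.conj_natCast]
  field_simp
  ring

end B05

/-! ## §4 THE JUNCTION: the periodised multiplier kernel of an2's system IS `2·N^{−(d+5)}·Δ_k` of (1.65) on every torus -/

section Junction

variable {d : ℕ} (N : ℕ) [NeZero N] (hN : 1 ≤ N) (M : Fin (d + 1) → ℕ) [∀ ν, NeZero (M ν)] (a : ℝ) (ha : 0 < a)

/-- **THE GRAM IDENTITY**: an2's and b05's torus columns have the same curl Gram matrix. -/
theorem gram_colA_eq_gram_colB (b b' : Tor M × Fin (d + 1)) :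
    star (CurlOp (fine N M) (N : ℂ) *ᵥ colA N M b) ⬝ᵥ (CurlOp (fine N M) (N : ℂ) *ᵥ colA N M b')
      = star (CurlOp (fine N M) (N : ℂ) *ᵥ colB N hN M a ha b) ⬝ᵥ (CurlOp (fine N M) (N : ℂ) *ᵥ colB N hN M a ha b') :=
  gram_eq_of_weak (CurlOp (fine N M) (N : ℂ)) (QvOp N M) (colA N M) (colB N hN M a ha)
    (fun i => by rw [QvOp_colA, QvOp_colB]) (fun i w hw => weak_colA N M i w hw) (fun i w hw => weak_colB N hN M a ha i w hw) b b'

/-- **THE S6-mm JUNCTION ON THE TORUS, bond form**: `Φ^per_{b′}(b) = 2·N^{−(d+5)}·Δ_k(b, b′)`. -/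
theorem Φper_eq_DelK (b b' : Tor M × Fin (d + 1)) :
    ((Φper N M b'.2 (liftT b'.1) b.2 (liftT b.1) : ℝ) : ℂ) = 2 * ((N : ℂ) ^ (d + 5))⁻¹ * DelK N hN M a ha b b' := by
  have hN0 : (N : ℂ) ≠ 0 := Nat.cast_ne_zero.2 (NeZero.ne N)
  have h := gram_colA_eq_gram_colB N hN M a ha b b'
  rw [gram_colA, gram_colB] at h
  have h2 : ((Φper N M b'.2 (liftT b'.1) b.2 (liftT b.1) : ℝ) : ℂ) = ((N : ℂ) ^ 2)⁻¹ * (2 * ((N : ℂ) ^ (d + 3))⁻¹ * DelK N hN M a ha b b') := by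
    rw [← h, ← mul_assoc, inv_mul_cancel₀ (pow_ne_zero _ hN0), one_mul]
  rw [h2]
  field_simp
  ring

/-- **THE S6-mm JUNCTION ON THE TORUS** (every blocking `N ≥ 1`, every torus `M`, every dimension; `a > 0` the dummy parameter of `DelK`,
on which it does not depend, `BlockEffectiveAction.DelK_indep`): the `M`-PERIODISATION of an2's multiplier-response kernel `wΦ^{(N)}` IS
`2·N^{−(d+5)}` times the genuine (1.65) block effective action `Δ_k` of b05/an5 at `n = N`:
`Σ_{t ∈ ℤ^{d+1}} wΦ κ l (z + pshift M t) = 2·N^{−(d+5)} · Re Δ_k((z mod M, κ), (0, l))`. -/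
theorem tsum_wΦ_pshift_eq_DelK (κ l : Fin (d + 1)) (z : Site (d + 1)) :
    ∑' t : Site (d + 1), wΦ (N := N) κ l (z + pshift M t)
      = 2 * ((N : ℝ) ^ (d + 5))⁻¹ * (DelK N hN M a ha (toTor M z, κ) (0, l)).re := by
  have h := Φper_eq_DelK N hN M a ha (toTor M z, κ) ((0 : Tor M), l)
  have hΦ : Φper N M l (liftT (0 : Tor M)) κ (liftT (toTor M z)) = ∑' t : Site (d + 1), wΦ (N := N) κ l (z + pshift M t) := by
    have h0 : toTor M (0 : Site (d + 1)) = 0 := by funext ν; simp [toTor]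
    rw [Φper_congr N M l (q' := (0 : Site (d + 1))) (y' := z)
      (by rw [toTor_sub, toTor_sub, toTor_liftT, toTor_liftT, sub_zero, h0, sub_zero])]
    simp only [Φper, HΦcol_sub_pshift, sub_zero]
  rw [← hΦ]
  have hre := congr_arg Complex.re h
  rw [Complex.ofReal_re, show (2 : ℂ) * ((N : ℂ) ^ (d + 5))⁻¹ = (((2 : ℝ) * ((N : ℝ) ^ (d + 5))⁻¹ : ℝ) : ℂ) by push_cast; ring,
    Complex.re_ofReal_mul] at hre
  exact hre

end Junction

end

end Summit.QuantumFields.BalabanUV.Beta.GAN24.TorusJunction
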